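import Mathlib
import Literature.Analysis.Fourier.HilbertTransformLineL2Density
import HarnessLib

/-!
# The weighted `L²` isometry of the line Hilbert transform for MEAN-ZERO functions

`Literature/Analysis/Fourier`. `HilbertTransformLineL2Density.integral_weight_mul_hilbertTransform_sq_eq_of_memLp` proves
`∫ (c + x²)(Hf)² = ∫ (c + x²) f²` for ODD real `f ∈ L¹ ∩ L²` with `x·f ∈ L²`. Oddness enters only through `∫ f = 0`
(the moment formula `H[y f] = x·Hf − π⁻¹∫f`, King eq. (19.150), loses its constant term). This file records the general
MEAN-ZERO form:

* `integral_weight_mul_hilbertTransform_sq_eq_of_integral_zero` — for real `f ∈ L¹ ∩ L²` with `∫ f = 0`, `x·f ∈ L²` and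
  everywhere-integrable symmetric p.v. integrand: `x·Hf ∈ L²` and `∫(c+x²)(Hf)² = ∫(c+x²)f²` for every real `c`
  [cite: King2009HilbertTransforms2, eq. (19.270)] [cite: Grafakos2014, eq. (5.1.14)].

Same proof as the odd version with `hilbertTransform_mul_id_of_integral_zero` in place of `hilbertTransform_mul_id_of_odd`.
MOTIVATION (cell ns-blowup, zone Z3, case Z3-SR-SPEC EVEN half): the even certificate class `E⁺₀ = even ZERO-MASS H¹_{L²+ξ²}`
needs «`‖Hδ‖_w = ‖δ‖_w` for even zero-mass `δ`» (DESIGN-Z3-SR-SPEC-EVEN (D3)); evenness is irrelevant, zero mass is what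
counts. No definitions. WHAT THIS IS NOT: not Navier–Stokes.
-/

namespace Literature.Analysis.Fourier

open _root_.MeasureTheory Set Filter
open scoped Real Topology ENNReal

/-- **Weighted isometry for mean-zero functions**: for real `f ∈ L¹ ∩ L²` with `∫ f = 0` and `x·f(x) ∈ L²` (i.e.
`f ∈ L²((c+ξ²)dξ)`) whose symmetric p.v. integrand is integrable on `(0,∞)` at every point, and every real `c`:
`x·Hf ∈ L²` and `∫ (c + x²)(Hf x)² dx = ∫ (c + x²) f(x)² dx` (King 2009, Vol. 2, eq. (19.270): `H[y f] = x·Hf` when `∫f = 0`,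
combined with the `L²` isometry, Grafakos eq. (5.1.14)).
[cite: King2009HilbertTransforms2, eq. (19.270)] -/
theorem integral_weight_mul_hilbertTransform_sq_eq_of_integral_zero {f : ℝ → ℝ} (hf : Integrable f)
    (h0 : ∫ y, f y = 0) (hf2 : MemLp f 2) (hxf2 : MemLp (fun y => y * f y) 2)
    (hint : ∀ x : ℝ, IntegrableOn (fun t => (f (x - t) - f (x + t)) / t) (Ioi 0)) (c : ℝ) :
    MemLp (fun x => x * hilbertTransform f x) 2 ∧
      ∫ x, (c + x ^ 2) * (hilbertTransform f x) ^ 2 = ∫ x, (c + x ^ 2) * (f x) ^ 2 := by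
  -- the p.v. integrand of `y f(y)` is integrable everywhere, and `H[y f] = x·Hf` pointwise (mean zero)
  have hint' : ∀ x : ℝ, IntegrableOn (fun t => ((x - t) * f (x - t) - (x + t) * f (x + t)) / t) (Ioi 0) :=
    fun x => integrableOn_symmIntegrand_id_mul hf (hint x)
  have hG := eLpNorm_hilbertTransform_eq_of_memLp hxf2 hint'
  have hpt : (fun x => x * hilbertTransform f x) = hilbertTransform (fun y => y * f y) := by
    funext x; exact (hilbertTransform_mul_id_of_integral_zero hf (hint x) h0).symm
  have hxH : MemLp (fun x => x * hilbertTransform f x) 2 := by rw [hpt]; exact hG.1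
  refine ⟨hxH, ?_⟩
  -- squares: `∫ (x Hf)² = ∫ (x f)²` from the `eLpNorm` identity
  have hsq : ∫ x, (x * hilbertTransform f x) ^ 2 = ∫ x, (x * f x) ^ 2 := by
    have h := hG.2
    rw [← hpt] at h
    rw [eLpNorm_eq_lintegral_rpow_enorm_toReal two_ne_zero ENNReal.ofNat_ne_top,
      eLpNorm_eq_lintegral_rpow_enorm_toReal two_ne_zero ENNReal.ofNat_ne_top] at h
    simp only [ENNReal.toReal_ofNat, one_div, ENNReal.rpow_two] at h
    have h' : (∫⁻ x, ‖x * hilbertTransform f x‖ₑ ^ 2) = ∫⁻ x, ‖x * f x‖ₑ ^ 2 := by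
      have h2 := congrArg (fun x : ℝ≥0∞ => x ^ (2 : ℝ)) h
      simp only [← ENNReal.rpow_mul, show (2 : ℝ)⁻¹ * 2 = 1 by norm_num, ENNReal.rpow_one] at h2
      exact h2
    rw [integral_eq_lintegral_of_nonneg_ae (ae_of_all _ fun x => sq_nonneg _)
        hxH.integrable_sq.aestronglyMeasurable,
      integral_eq_lintegral_of_nonneg_ae (ae_of_all _ fun x => sq_nonneg _)
        hxf2.integrable_sq.aestronglyMeasurable]
    have e : ∀ (φ : ℝ → ℝ) (x : ℝ), ENNReal.ofReal (φ x ^ 2) = ‖φ x‖ₑ ^ 2 := fun φ x => by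
      rw [← ofReal_norm, Real.norm_eq_abs, ← ENNReal.ofReal_pow (abs_nonneg _), sq_abs]
    simp_rw [e, h']
  have hH2 : Integrable (fun x => (hilbertTransform f x) ^ 2) :=
    (memLp_two_hilbertTransform hf hf2 (ae_of_all _ hint)).integrable_sq
  have hxH2 : Integrable (fun x => (x * hilbertTransform f x) ^ 2) := hxH.integrable_sq
  have hf2' : Integrable (fun x => (f x) ^ 2) := hf2.integrable_sq
  have hxf2' : Integrable (fun x => (x * f x) ^ 2) := hxf2.integrable_sq
  have e1 : (fun x => (c + x ^ 2) * (hilbertTransform f x) ^ 2) =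
      fun x => c * (hilbertTransform f x) ^ 2 + (x * hilbertTransform f x) ^ 2 := by
    funext x; ring
  have e2 : (fun x => (c + x ^ 2) * (f x) ^ 2) = fun x => c * (f x) ^ 2 + (x * f x) ^ 2 := by
    funext x; ring
  rw [e1, e2, integral_add (hH2.const_mul c) hxH2, integral_add (hf2'.const_mul c) hxf2', integral_const_mul,
    integral_const_mul, integral_hilbertTransform_sq_eq hf hf2 (ae_of_all _ hint), hsq]

/-- The `(L² + ξ²)`-weighted form used by the sheet-ℝ frame: for real `f ∈ L¹` with `∫ f = 0`, a.e.-strongly measurable,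
`∫(L²+y²)f² < ∞` (`L > 0`) and everywhere-integrable symmetric p.v. integrand, `(L²+y²)(Hf)² ∈ L¹` and
`∫(L²+y²)(Hf)² = ∫(L²+y²)f²` («`‖Hf‖_w = ‖f‖_w` on the mean-zero weighted class»). [cite: King2009HilbertTransforms2, eq. (19.270)] -/
theorem weightedSq_hilbertTransform_of_integral_zero {f : ℝ → ℝ} {L : ℝ} (hL : 0 < L) (hf : Integrable f)
    (h0 : ∫ y, f y = 0) (hfm : AEStronglyMeasurable f volume) (hw : Integrable fun y => (L ^ 2 + y ^ 2) * f y ^ 2)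
    (hint : ∀ x : ℝ, IntegrableOn (fun t => (f (x - t) - f (x + t)) / t) (Ioi 0)) :
    Integrable (fun y => (L ^ 2 + y ^ 2) * hilbertTransform f y ^ 2) ∧
      ∫ y, (L ^ 2 + y ^ 2) * hilbertTransform f y ^ 2 = ∫ y, (L ^ 2 + y ^ 2) * f y ^ 2 := by
  -- `f ∈ L²` and `y f ∈ L²` from the weighted bound
  have hL2 : 0 < L ^ 2 := by positivity
  have hf2 : MemLp f 2 := by
    rw [memLp_two_iff_integrable_sq hfm]
    refine ((hw.div_const (L ^ 2)).mono' (hfm.pow 2) (Eventually.of_forall fun y => ?_))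
    rw [Real.norm_eq_abs, abs_of_nonneg (sq_nonneg _), le_div_iff₀ hL2]
    nlinarith [sq_nonneg y, sq_nonneg (f y), mul_nonneg (sq_nonneg y) (sq_nonneg (f y))]
  have hxfm : AEStronglyMeasurable (fun y => y * f y) volume := (continuous_id.aestronglyMeasurable).mul hfm
  have hxf2 : MemLp (fun y => y * f y) 2 := by
    rw [memLp_two_iff_integrable_sq hxfm]
    refine (hw.mono' (hxfm.pow 2) (Eventually.of_forall fun y => ?_))
    rw [Real.norm_eq_abs, abs_of_nonneg (sq_nonneg _)]
    nlinarith [sq_nonneg y, sq_nonneg (f y), mul_nonneg hL2.le (sq_nonneg (f y))]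
  obtain ⟨hxH, hiso⟩ := integral_weight_mul_hilbertTransform_sq_eq_of_integral_zero hf h0 hf2 hxf2 hint (L ^ 2)
  have hH2 : MemLp (hilbertTransform f) 2 := memLp_two_hilbertTransform hf hf2 (ae_of_all _ hint)
  have hint' : Integrable fun y => (L ^ 2 + y ^ 2) * hilbertTransform f y ^ 2 := by
    have h := (hH2.integrable_sq.const_mul (L ^ 2)).add hxH.integrable_sq
    refine h.congr (Eventually.of_forall fun y => ?_)
    simp only [Pi.add_apply]
    ring
  exact ⟨hint', hiso⟩

end Literature.Analysis.Fourier
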